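import Summits.BirchSwinnertonDyer.Rank1Residual.GaloisImage.VisibleWitnessCertificates
import Summits.BirchSwinnertonDyer.Rank1Residual.Additive.X4RankZeroVisibleLowerBound
import Summits.BirchSwinnertonDyer.Rank1Residual.X11b.VisibilityPrimeList
import HarnessLib

/-!
# X4 ∧ `r = 0`: `BSD(E,3)` from a VISIBLE element of `Ш(E)[3]` supplied by the WITNESS ROAD's
# kernel certificates — the twins of n1011-p03's `X4RankZero.bsdp_*_of_congr_of_rank_two*` with the
# rank-`2` binder `hrank` and the local counts `hloc` REPLACED by a rational point of the partner and
# `decide`-able certificates (team n1011, row T-DIV3L, FILE D6 — lead R5-83 (d) / R5-84 (e))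

HONEST FRAMING (cell `b2b-bsdres`, run/shared/lean/b2b/bsd-rank1-residual/, verbatim in every
file): the goal of the cell is to DELETE the COMBINATION-SHAPED residual classes of the
Birch–Swinnerton-Dyer formula for ALL analytic-rank `≤ 1` elliptic curves over `ℚ` — "full BSD
formula for every rank `≤ 1` curve in class `C`" assembled STRICTLY from published theorems — so
that the rank-`≤ 1` remainder becomes exactly the CONSTRUCTION-SHAPED classes, which are TYPED
(missing-input `Prop`s), NOT attempted. This is not "finishing BSD". Team n1011 (N10/N11): research
route on the CONSTRUCTION-SHAPED class X4; END theorems only (no definition, no named fact, no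
`sorry`); CONDITIONAL on exactly the named inputs displayed as hypotheses (Kato 14.5 (3) /
Delbourgo (M) / Gross–Zagier–Kolyvagin / modularity / Kato's half eigen-ideal / Cassels–Tate, as in
n1011-p03's ENDs); nothing is booked; no mark / label / count moved; X4 stays CONSTRUCTION-SHAPED.

## What

n1011-p03's two T-VIS3 ENDs (`Additive/X4RankZeroVisibleLowerBound.lean`, p304185) close `BSDp W 3`
on an X4 ∧ `r = 0` row from the UPPER half and a visible non-zero element of `Ш(E)[3]`, the latter
by the COUNT road (`exists_sha_ne_zero_of_congr_of_rank`: a `3`-congruent partner of Mordell–Weil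
rank `≥ 2` with `#E′(ℚ_v)[3] = 1` on `S`). This file gives the WITNESS-road twins: the visible
element comes from FILE D5 `DivisionDecider.exists_sha_ne_zero_of_congr_of_witnessChecks` — a
rational point `(x, y) ∈ E′(ℚ)` with the kernel certificates `threeNonDivCheckAt` (`P ∉ 3E′(ℚ)` at
one auxiliary prime) and `witnessLocalChecksAt` (a cube root of `P` in `E′(ℚ_q)`, or `q ≠ 3` and
`E′(ℚ_q)[3] = 0`, at every prime `q` of a list `L ∋ 3` supporting both discriminants) — so NO rank
statement about `E′` and NO local count at `3` is needed (r1 ROUTE-1 §41.9 road F3:W; the 480 + 55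
FAIL@3 witness pairs of §41.7 all carry both certificates, `HOME/b2b-bsdres-n1011-p17/gen9/census/`).

* `X4RankZero.bsdp_of_congr_of_witnessChecks_of_kato` — potentially GOOD at `3` (Kato + Manin);
* `X4RankZero.bsdp_three_potMult_of_congr_of_witnessChecks` — potentially MULTIPLICATIVE at `3`
  ((M)-chain: Delbourgo + Kato S + Kato χ);
* the HYBRID twins `…_of_relIndex` of both: certificates on `L ∖ Lrel`, and at the places over `Lrel`
  (r1's kinds (ii)/(iii): both curves multiplicative with `#E′(ℚ_q)[3] = 3`) the displayed comparison
  `ι_v(θ) = 1` — census: 202 of r1's 535 FAIL@3 witness pairs need no `Lrel`, 333 need 1–2 places.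

`E(ℚ)` finite and of order prime to `3` are DERIVED (analytic rank `0` via `hGZK`; `ρ̄_{E,3}`
irreducible from `hsurj`), exactly as in p03's ENDs. Binder lists = p304185's VERBATIM except the
stated swap (referee-1 GEN 34 (viii)); these ENDs close nothing beyond their displayed binders — in a
record, `hsurj` comes from n1011-p14's `GaloisImage.surj3_frob_v<L>` / `towerSurj3u_frob_v<L>`
instances BY NAME, `θ` from a KO / Hesse certificate or as EVIDENCE, `hr` / `hq` / `hv` / Manin as
EVIDENCE binders; nothing is booked by this file. PILOT (§ Pilot): `X4RankZero.exists_sha_ne_zero_225405c1`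
— `Ш(E/ℚ)[3] ≠ 0` for the FAIL@3 witness pair `225405c1 ~ 75135b1` (witness `P = (7, 5)`,
`L = [3, 5, 5009]`, `ℓ₀ = 13`) with ONLY `θ`, `Finite E(ℚ)`, coprimality and the point's nonsingularity
displayed; `h3L`, the two factorisation certificates (x11c's `X11b.forall_mem_of_natAbs_eq_prod_pow`),
`hP` and the three local certificates by `decide (+kernel)`.

References: [CremonaMazur2000] §3; [AgasheStein2002] Lemma 3.6, Thm. 3.1;
[Kato2004Asterisque] Thm. 14.5 (3); [Delbourgo1998] Prop. 4; [SilvermanAEC2009] X.4.14, VII.5.1(a).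
-/

set_option autoImplicit false

noncomputable section

open scoped Classical

open WeierstrassCurve Literature.NumberTheory.EllipticCurves
  Literature.NumberTheory.EllipticCurves.ModularForms
  Literature.NumberTheory.EllipticCurves.Rank1Residual
  Literature.NumberTheory.EllipticCurves.Rank1Residual.Typed
  Literature.NumberTheory.GaloisRepresentations
  NumberField IsDedekindDomain
open Summit.BirchSwinnertonDyer.Rank1Residual.GaloisImage.DivisionDecider
  (threeNonDivCheckAt witnessLocalChecksAt exists_sha_ne_zero_of_congr_of_witnessChecks
    exists_sha_ne_zero_of_congr_of_witnessChecks_of_relIndex)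

namespace Summit.BirchSwinnertonDyer.Rank1Residual.Additive

/-- **X4 ∧ `r = 0`, potentially GOOD at `3`, `ord₃ #Ш_an ≤ 2`: `BSD(E,3)` from Kato's UPPER half and a
VISIBLE element of `Ш(E)[3]` supplied by the WITNESS road** — a `3`-congruent curve `E′ = ⟨a₁,…,a₆⟩`,
a point `(x, y) ∈ E′(ℚ)` and the kernel certificates of FILE D5 (`P ∉ 3E′(ℚ)`; local divisibility /
trivial `3`-torsion at the primes of `L`). Composition: `exists_sha_ne_zero_of_congr_of_witnessChecks`
→ `dvd_shaOrder_of_exists_torsion` → Cassels–Tate → `X4RankZero.bsdp_of_missingLowerBoundAt_of_kato`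
(verbatim the tail of p03's `X4RankZero.bsdp_of_congr_of_rank_two_of_kato`).
[cite: CremonaMazur2000, §3 and Table 1] [cite: AgasheStein2002, Lemma 3.6]
[cite: Kato2004Asterisque, Thm. 14.5 (3) (p. 236)] [cite: SilvermanAEC2009, Thm. X.4.14] -/
theorem X4RankZero.bsdp_of_congr_of_witnessChecks_of_kato
    (hKato : Kato2004.rankZero_padicValNat_sha_le_of_additive_potGood_of_imageContainsSL2)
    (hCT : exists_casselsTate_pairing (K := ℚ))
    (hGZK : rank_eq_analyticRank_of_analyticRank_le_one) (hmod : hasEntireLFunction_rat)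
    (W : WeierstrassCurve ℚ) [W.IsElliptic] [W.IsGloballyMinimal]
    (hr : W.analyticRank = 0) (hX : haveI : Fact (Nat.Prime 3) := ⟨Nat.prime_three⟩; ClassX4 W 3)
    (hpot : 0 ≤ padicValRat 3 W.j)
    (hsurj : ∀ n : ℕ, W.HasSurjectiveModNGaloisRep (3 ^ n : ℕ)) (htam : ¬ 3 ∣ W.tamagawaProduct)
    {N : ℕ} [NeZero N] (D : ModularParametrizationData W N) (hc : ¬ (3 : ℤ) ∣ D.maninConstant)
    {q : ℚ} (hq : shaAn W = (q : ℂ)) (hv : padicValRat 3 q ≤ 2)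
    (W' : WeierstrassCurve ℚ) [W'.IsElliptic]
    (θ : geomTorsion W' ((3 : ℕ) : ℤ) ≃+ geomTorsion W ((3 : ℕ) : ℤ))
    (hθ : ∀ (σ : Field.absoluteGaloisGroup ℚ) (P : geomTorsion W' ((3 : ℕ) : ℤ)),
      θ (σ • P) = σ • θ P)
    {E₀ : WeierstrassCurve ℤ} (hE : E₀.map (Int.castRingHom ℚ) = W)
    (a₁ a₂ a₃ a₄ a₆ : ℤ) (hW' : W' = ⟨a₁, a₂, a₃, a₄, a₆⟩) (L : List ℕ) (h3L : 3 ∈ L)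
    (hΔE : ∀ r : ℕ, r.Prime → (r : ℤ) ∣ E₀.Δ → r ∈ L)
    (hΔF : ∀ r : ℕ, r.Prime → (r : ℤ) ∣ (⟨a₁, a₂, a₃, a₄, a₆⟩ : WeierstrassCurve ℤ).Δ → r ∈ L)
    {x y : ℚ} (h : W'.toAffine.Nonsingular x y)
    {ℓ₀ : ℕ} [hℓ₀ : Fact ℓ₀.Prime] {k₀ : ℕ}
    (hP : threeNonDivCheckAt ℓ₀ a₁ a₂ a₃ a₄ a₆ x.num x.den k₀ = true)
    {Dc : List (ℕ × (ℤ × ℕ × ℕ × ℕ))} {Tc : List (ℕ × ℕ × List (ℤ × ℕ × ℕ × ℕ))}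
    (hlc : witnessLocalChecksAt a₁ a₂ a₃ a₄ a₆ x.num x.den L Dc Tc = true) :
    haveI : Fact (Nat.Prime 3) := ⟨Nat.prime_three⟩
    BSDp W 3 := by
  haveI : Fact (Nat.Prime 3) := ⟨Nat.prime_three⟩
  haveI : Finite W.toAffine.Point := finite_point_of_analyticRank_eq_zero W hGZK hr
  have hirr : Irr W 3 :=
    hasIrreducibleModPGaloisRep_of_hasSurjectiveModNGaloisRep W 3 (by simpa using hsurj 1)
  have hvis : ∃ c : W.sha, c ≠ 0 ∧ 3 • c = 0 :=
    exists_sha_ne_zero_of_congr_of_witnessChecks a₁ a₂ a₃ a₄ a₆ W W' θ hθ hE hW' L h3L hΔE hΔF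
      ‹_› (coprime_natCard_point_of_irr W 3 hirr) h hP hlc
  have hlow : MissingLowerBoundAt W 3 :=
    missingLowerBoundAt_of_casselsTate_of_pow_dvd W 3 hCT (hGZK W (by omega)).2 hq (k := 1)
      (by simpa using hv) (by simpa using dvd_shaOrder_of_exists_torsion W 3 hvis)
  exact X4RankZero.bsdp_of_missingLowerBoundAt_of_kato W 3 hKato hGZK hmod hr hX hpot hsurj htam D hc
    hlow

/-- **X4 ∧ `r = 0`, potentially MULTIPLICATIVE at `3`, `ρ̄_{E,3}` onto, `ord₃ #Ш_an ≤ 2`: `BSD(E,3)`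
from the (M)-chain UPPER half and a VISIBLE element of `Ш(E)[3]` supplied by the WITNESS road** (FILE
D5's certificates in place of the rank-`2` count). Composition:
`exists_sha_ne_zero_of_congr_of_witnessChecks` → `exists_selmerToSha_eq` (`Sel^(3) ↠ Ш[3]`) →
additive-p1's `X4RankZero.bsdp_three_potMult_of_selmerGroup_ne_bot_noL20` (verbatim the tail of p03's
`X4RankZero.bsdp_three_potMult_of_congr_of_rank_two`). [cite: CremonaMazur2000, §3 and Table 1]
[cite: AgasheStein2002, Lemma 3.6] [cite: Delbourgo1998, Prop. 4 (p. 144)]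
[cite: SilvermanAEC2009, Thm. X.4.2 (a) and X.4.14] -/
theorem X4RankZero.bsdp_three_potMult_of_congr_of_witnessChecks
    (hKatoS : Kato2004.rankZero_padicValNat_sha_le_sub_localTamagawa_of_additive_potGood_of_imageContainsSL2)
    (hDel : Delbourgo1998.prop4_rankZero_pow_dvd_constantCoeff)
    (hGZK : rank_eq_analyticRank_of_analyticRank_le_one) (hmod : hasEntireLFunction_rat)
    (hmodD : nonempty_modularParametrizationData)
    (hKatoχ : Wuthrich2014.kato_halfEigenCharIdeal_dvd_cyclotomicPrime_of_surjective)
    (hCT : exists_casselsTate_pairing (K := ℚ))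
    (W : WeierstrassCurve ℚ) [W.IsElliptic] [W.IsGloballyMinimal] (hr : W.analyticRank = 0)
    (hX : haveI : Fact (Nat.Prime 3) := ⟨Nat.prime_three⟩; ClassX4 W 3)
    (hsurj : W.HasSurjectiveModNGaloisRep 3) (hj : padicValRat 3 W.j < 0)
    {q : ℚ} (hq : shaAn W = (q : ℂ)) (hv : padicValRat 3 q ≤ 2)
    (W' : WeierstrassCurve ℚ) [W'.IsElliptic]
    (θ : geomTorsion W' ((3 : ℕ) : ℤ) ≃+ geomTorsion W ((3 : ℕ) : ℤ))
    (hθ : ∀ (σ : Field.absoluteGaloisGroup ℚ) (P : geomTorsion W' ((3 : ℕ) : ℤ)),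
      θ (σ • P) = σ • θ P)
    {E₀ : WeierstrassCurve ℤ} (hE : E₀.map (Int.castRingHom ℚ) = W)
    (a₁ a₂ a₃ a₄ a₆ : ℤ) (hW' : W' = ⟨a₁, a₂, a₃, a₄, a₆⟩) (L : List ℕ) (h3L : 3 ∈ L)
    (hΔE : ∀ r : ℕ, r.Prime → (r : ℤ) ∣ E₀.Δ → r ∈ L)
    (hΔF : ∀ r : ℕ, r.Prime → (r : ℤ) ∣ (⟨a₁, a₂, a₃, a₄, a₆⟩ : WeierstrassCurve ℤ).Δ → r ∈ L)
    {x y : ℚ} (h : W'.toAffine.Nonsingular x y)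
    {ℓ₀ : ℕ} [hℓ₀ : Fact ℓ₀.Prime] {k₀ : ℕ}
    (hP : threeNonDivCheckAt ℓ₀ a₁ a₂ a₃ a₄ a₆ x.num x.den k₀ = true)
    {Dc : List (ℕ × (ℤ × ℕ × ℕ × ℕ))} {Tc : List (ℕ × ℕ × List (ℤ × ℕ × ℕ × ℕ))}
    (hlc : witnessLocalChecksAt a₁ a₂ a₃ a₄ a₆ x.num x.den L Dc Tc = true) :
    haveI : Fact (Nat.Prime 3) := ⟨Nat.prime_three⟩
    BSDp W 3 := by
  haveI : Fact (Nat.Prime 3) := ⟨Nat.prime_three⟩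
  haveI : Finite W.toAffine.Point := finite_point_of_analyticRank_eq_zero W hGZK hr
  have hirr : Irr W 3 := hasIrreducibleModPGaloisRep_of_hasSurjectiveModNGaloisRep W 3 hsurj
  obtain ⟨c, hc0, hc3⟩ : ∃ c : W.sha, c ≠ 0 ∧ 3 • c = 0 :=
    exists_sha_ne_zero_of_congr_of_witnessChecks a₁ a₂ a₃ a₄ a₆ W W' θ hθ hE hW' L h3L hΔE hΔF
      ‹_› (coprime_natCard_point_of_irr W 3 hirr) h hP hlc
  -- `Sel^(3)(E/ℚ) ↠ Ш(E/ℚ)[3]`: a preimage of the visible class is a non-zero Selmer element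
  obtain ⟨z, hz⟩ := exists_selmerToSha_eq W (n := ((3 : ℕ) : ℤ)) (by norm_num) c (by exact_mod_cast hc3)
  have hSel : W.selmerGroup ((3 : ℕ) : ℤ) ≠ ⊥ := by
    intro hbot
    have hmem : (z : W.galH1Torsion ((3 : ℕ) : ℤ)) ∈ (⊥ : AddSubgroup _) := hbot ▸ z.2
    have hz0 : z = 0 := Subtype.ext ((AddSubgroup.mem_bot).mp hmem)
    exact hc0 (by rw [← hz, hz0, map_zero])
  exact X4RankZero.bsdp_three_potMult_of_selmerGroup_ne_bot_noL20 W hKatoS hDel hGZK hmod hmodD hKatoχ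
    hCT hr hX hsurj hj hq hv hSel

/-- **HYBRID twin** of `X4RankZero.bsdp_of_congr_of_witnessChecks_of_kato`: kernel certificates on
`L ∖ Lrel`, the displayed comparison `ι_v(θ) = 1` at the places over `Lrel` (FILE D5
`exists_sha_ne_zero_of_congr_of_witnessChecks_of_relIndex`). [cite: CremonaMazur2000, §3 and Table 1]
[cite: Kato2004Asterisque, Thm. 14.5 (3) (p. 236)] [cite: MilneADT2006, I Lemma 3.3] -/
theorem X4RankZero.bsdp_of_congr_of_witnessChecks_of_relIndex_of_kato
    (hKato : Kato2004.rankZero_padicValNat_sha_le_of_additive_potGood_of_imageContainsSL2)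
    (hCT : exists_casselsTate_pairing (K := ℚ))
    (hGZK : rank_eq_analyticRank_of_analyticRank_le_one) (hmod : hasEntireLFunction_rat)
    (W : WeierstrassCurve ℚ) [W.IsElliptic] [W.IsGloballyMinimal]
    (hr : W.analyticRank = 0) (hX : haveI : Fact (Nat.Prime 3) := ⟨Nat.prime_three⟩; ClassX4 W 3)
    (hpot : 0 ≤ padicValRat 3 W.j)
    (hsurj : ∀ n : ℕ, W.HasSurjectiveModNGaloisRep (3 ^ n : ℕ)) (htam : ¬ 3 ∣ W.tamagawaProduct)
    {N : ℕ} [NeZero N] (D : ModularParametrizationData W N) (hc : ¬ (3 : ℤ) ∣ D.maninConstant)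
    {q : ℚ} (hq : shaAn W = (q : ℂ)) (hv : padicValRat 3 q ≤ 2)
    (W' : WeierstrassCurve ℚ) [W'.IsElliptic]
    (θ : geomTorsion W' ((3 : ℕ) : ℤ) ≃+ geomTorsion W ((3 : ℕ) : ℤ))
    (hθ : ∀ (σ : Field.absoluteGaloisGroup ℚ) (P : geomTorsion W' ((3 : ℕ) : ℤ)),
      θ (σ • P) = σ • θ P)
    {E₀ : WeierstrassCurve ℤ} (hE : E₀.map (Int.castRingHom ℚ) = W)
    (a₁ a₂ a₃ a₄ a₆ : ℤ) (hW' : W' = ⟨a₁, a₂, a₃, a₄, a₆⟩) (L : List ℕ) (h3L : 3 ∈ L)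
    (hΔE : ∀ r : ℕ, r.Prime → (r : ℤ) ∣ E₀.Δ → r ∈ L)
    (hΔF : ∀ r : ℕ, r.Prime → (r : ℤ) ∣ (⟨a₁, a₂, a₃, a₄, a₆⟩ : WeierstrassCurve ℤ).Δ → r ∈ L)
    {x y : ℚ} (h : W'.toAffine.Nonsingular x y)
    {ℓ₀ : ℕ} [hℓ₀ : Fact ℓ₀.Prime] {k₀ : ℕ}
    (hP : threeNonDivCheckAt ℓ₀ a₁ a₂ a₃ a₄ a₆ x.num x.den k₀ = true)
    (Lrel : List ℕ)
    (hrel : ∀ v : HeightOneSpectrum (𝓞 ℚ), (Rat.HeightOneSpectrum.primesEquiv v : ℕ) ∈ Lrel →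
      (selmerLocalKer W (v.adicCompletion ℚ) ((3 : ℕ) : ℤ)).relIndex
        ((selmerLocalKer W' (v.adicCompletion ℚ) ((3 : ℕ) : ℤ)).map
          (h1Equiv θ hθ).toAddMonoidHom) = 1)
    {Dc : List (ℕ × (ℤ × ℕ × ℕ × ℕ))} {Tc : List (ℕ × ℕ × List (ℤ × ℕ × ℕ × ℕ))}
    (hlc : witnessLocalChecksAt a₁ a₂ a₃ a₄ a₆ x.num x.den (L.filter fun r => r ∉ Lrel) Dc Tc =
      true) :
    haveI : Fact (Nat.Prime 3) := ⟨Nat.prime_three⟩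
    BSDp W 3 := by
  haveI : Fact (Nat.Prime 3) := ⟨Nat.prime_three⟩
  haveI : Finite W.toAffine.Point := finite_point_of_analyticRank_eq_zero W hGZK hr
  have hirr : Irr W 3 :=
    hasIrreducibleModPGaloisRep_of_hasSurjectiveModNGaloisRep W 3 (by simpa using hsurj 1)
  have hvis : ∃ c : W.sha, c ≠ 0 ∧ 3 • c = 0 :=
    exists_sha_ne_zero_of_congr_of_witnessChecks_of_relIndex a₁ a₂ a₃ a₄ a₆ W W' θ hθ hE hW' L h3L
      hΔE hΔF ‹_› (coprime_natCard_point_of_irr W 3 hirr) h hP Lrel hrel hlc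
  have hlow : MissingLowerBoundAt W 3 :=
    missingLowerBoundAt_of_casselsTate_of_pow_dvd W 3 hCT (hGZK W (by omega)).2 hq (k := 1)
      (by simpa using hv) (by simpa using dvd_shaOrder_of_exists_torsion W 3 hvis)
  exact X4RankZero.bsdp_of_missingLowerBoundAt_of_kato W 3 hKato hGZK hmod hr hX hpot hsurj htam D hc
    hlow

/-- **HYBRID twin** of `X4RankZero.bsdp_three_potMult_of_congr_of_witnessChecks`: kernel
certificates on `L ∖ Lrel`, the displayed comparison `ι_v(θ) = 1` at the places over `Lrel`.
[cite: CremonaMazur2000, §3 and Table 1] [cite: Delbourgo1998, Prop. 4 (p. 144)]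
[cite: MilneADT2006, I Lemma 3.3] -/
theorem X4RankZero.bsdp_three_potMult_of_congr_of_witnessChecks_of_relIndex
    (hKatoS : Kato2004.rankZero_padicValNat_sha_le_sub_localTamagawa_of_additive_potGood_of_imageContainsSL2)
    (hDel : Delbourgo1998.prop4_rankZero_pow_dvd_constantCoeff)
    (hGZK : rank_eq_analyticRank_of_analyticRank_le_one) (hmod : hasEntireLFunction_rat)
    (hmodD : nonempty_modularParametrizationData)
    (hKatoχ : Wuthrich2014.kato_halfEigenCharIdeal_dvd_cyclotomicPrime_of_surjective)
    (hCT : exists_casselsTate_pairing (K := ℚ))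
    (W : WeierstrassCurve ℚ) [W.IsElliptic] [W.IsGloballyMinimal] (hr : W.analyticRank = 0)
    (hX : haveI : Fact (Nat.Prime 3) := ⟨Nat.prime_three⟩; ClassX4 W 3)
    (hsurj : W.HasSurjectiveModNGaloisRep 3) (hj : padicValRat 3 W.j < 0)
    {q : ℚ} (hq : shaAn W = (q : ℂ)) (hv : padicValRat 3 q ≤ 2)
    (W' : WeierstrassCurve ℚ) [W'.IsElliptic]
    (θ : geomTorsion W' ((3 : ℕ) : ℤ) ≃+ geomTorsion W ((3 : ℕ) : ℤ))
    (hθ : ∀ (σ : Field.absoluteGaloisGroup ℚ) (P : geomTorsion W' ((3 : ℕ) : ℤ)),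
      θ (σ • P) = σ • θ P)
    {E₀ : WeierstrassCurve ℤ} (hE : E₀.map (Int.castRingHom ℚ) = W)
    (a₁ a₂ a₃ a₄ a₆ : ℤ) (hW' : W' = ⟨a₁, a₂, a₃, a₄, a₆⟩) (L : List ℕ) (h3L : 3 ∈ L)
    (hΔE : ∀ r : ℕ, r.Prime → (r : ℤ) ∣ E₀.Δ → r ∈ L)
    (hΔF : ∀ r : ℕ, r.Prime → (r : ℤ) ∣ (⟨a₁, a₂, a₃, a₄, a₆⟩ : WeierstrassCurve ℤ).Δ → r ∈ L)
    {x y : ℚ} (h : W'.toAffine.Nonsingular x y)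
    {ℓ₀ : ℕ} [hℓ₀ : Fact ℓ₀.Prime] {k₀ : ℕ}
    (hP : threeNonDivCheckAt ℓ₀ a₁ a₂ a₃ a₄ a₆ x.num x.den k₀ = true)
    (Lrel : List ℕ)
    (hrel : ∀ v : HeightOneSpectrum (𝓞 ℚ), (Rat.HeightOneSpectrum.primesEquiv v : ℕ) ∈ Lrel →
      (selmerLocalKer W (v.adicCompletion ℚ) ((3 : ℕ) : ℤ)).relIndex
        ((selmerLocalKer W' (v.adicCompletion ℚ) ((3 : ℕ) : ℤ)).map
          (h1Equiv θ hθ).toAddMonoidHom) = 1)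
    {Dc : List (ℕ × (ℤ × ℕ × ℕ × ℕ))} {Tc : List (ℕ × ℕ × List (ℤ × ℕ × ℕ × ℕ))}
    (hlc : witnessLocalChecksAt a₁ a₂ a₃ a₄ a₆ x.num x.den (L.filter fun r => r ∉ Lrel) Dc Tc =
      true) :
    haveI : Fact (Nat.Prime 3) := ⟨Nat.prime_three⟩
    BSDp W 3 := by
  haveI : Fact (Nat.Prime 3) := ⟨Nat.prime_three⟩
  haveI : Finite W.toAffine.Point := finite_point_of_analyticRank_eq_zero W hGZK hr
  have hirr : Irr W 3 := hasIrreducibleModPGaloisRep_of_hasSurjectiveModNGaloisRep W 3 hsurj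
  obtain ⟨c, hc0, hc3⟩ : ∃ c : W.sha, c ≠ 0 ∧ 3 • c = 0 :=
    exists_sha_ne_zero_of_congr_of_witnessChecks_of_relIndex a₁ a₂ a₃ a₄ a₆ W W' θ hθ hE hW' L h3L
      hΔE hΔF ‹_› (coprime_natCard_point_of_irr W 3 hirr) h hP Lrel hrel hlc
  -- `Sel^(3)(E/ℚ) ↠ Ш(E/ℚ)[3]`: a preimage of the visible class is a non-zero Selmer element
  obtain ⟨z, hz⟩ := exists_selmerToSha_eq W (n := ((3 : ℕ) : ℤ)) (by norm_num) c (by exact_mod_cast hc3)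
  have hSel : W.selmerGroup ((3 : ℕ) : ℤ) ≠ ⊥ := by
    intro hbot
    have hmem : (z : W.galH1Torsion ((3 : ℕ) : ℤ)) ∈ (⊥ : AddSubgroup _) := hbot ▸ z.2
    have hz0 : z = 0 := Subtype.ext ((AddSubgroup.mem_bot).mp hmem)
    exact hc0 (by rw [← hz, hz0, map_zero])
  exact X4RankZero.bsdp_three_potMult_of_selmerGroup_ne_bot_noL20 W hKatoS hDel hGZK hmod hmodD hKatoχ
    hCT hr hX hsurj hj hq hv hSel

/-! ### Pilot: the Sha-level END on one FAIL@3 witness pair, every decidable binder discharged -/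

/-- **PILOT (EVIDENCE-grade `θ`, `#E(ℚ)`, nonsingularity displayed; everything else `decide`):
`225405c1 ~ 75135b1`** (r1 ROUTE-1 §41.7 FAIL@3 witness pair; target `E = [1,-1,0,-954,-11097]`,
`N = 3²·5·5009`, `r_an = 0`, `ord₃ #Ш_an = 2`; partner `E′ = [1,0,1,-63,163]` = `75135b1`; witness
`P = P₂ = (7, 5)`): `Ш(E/ℚ)[3] ≠ 0` from `θ : E′[3] ≃ E[3]` and KERNEL certificates — `P ∉ 3E′(ℚ)` at
`ℓ₀ = 13`, a cube root of `P` in `E′(ℚ_q)` at each `q ∈ {3, 5, 5009}`. [folklore] -/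
theorem X4RankZero.exists_sha_ne_zero_225405c1 (W W' : WeierstrassCurve ℚ) [W.IsElliptic] [W'.IsElliptic]
    (θ : geomTorsion W' ((3 : ℕ) : ℤ) ≃+ geomTorsion W ((3 : ℕ) : ℤ))
    (hθ : ∀ (σ : Field.absoluteGaloisGroup ℚ) (P : geomTorsion W' ((3 : ℕ) : ℤ)),
      θ (σ • P) = σ • θ P)
    (hW : W = ⟨1, -1, 0, -954, -11097⟩) (hW' : W' = ⟨1, 0, 1, -63, 163⟩)
    (hfin : Finite W.toAffine.Point) (hcop : (Nat.card W.toAffine.Point).Coprime 3)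
    (h : W'.toAffine.Nonsingular 7 5) :
    ∃ c : W.sha, c ≠ 0 ∧ 3 • c = 0 :=
  exists_sha_ne_zero_of_congr_of_witnessChecks 1 0 1 (-63) 163 W W' θ hθ
    (E₀ := ⟨1, -1, 0, -954, -11097⟩) (by subst hW; ext <;> simp [WeierstrassCurve.map]) hW'
    [3, 5, 5009] (by decide)
    (X11b.forall_mem_of_natAbs_eq_prod_pow [3, 5, 5009] [6, 2, 1] (by decide +kernel) (by decide +kernel))
    (X11b.forall_mem_of_natAbs_eq_prod_pow [3, 5, 5009] [3, 2, 1] (by decide +kernel) (by decide +kernel))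
    hfin hcop h (ℓ₀ := 13) (hℓ₀ := ⟨by norm_num⟩) (k₀ := 1) (by decide +kernel)
    (D := [(3, ((70 : ℤ), 2, 5, 2)), (5, ((2 : ℤ), 0, 1, 0)), (5009, ((1563 : ℤ), 0, 1, 0))])
    (T := []) (by decide +kernel)


end Summit.BirchSwinnertonDyer.Rank1Residual.Additive

end
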